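import Literature.AnabelianGeometry.EtaleTheta.ClassicalThetaZeros
import Mathlib.Analysis.Normed.Group.FunctionSeries
import Mathlib.Analysis.Calculus.Deriv.Slope
import Mathlib.Analysis.Calculus.Deriv.Mul
import Mathlib.Analysis.Calculus.Deriv.Comp
import Mathlib.Analysis.Calculus.Deriv.ZPow
import HarnessLib

/-!
# [EtTh] Proposition 1.4 (i) over nonarchimedean fields: the zeros of `Θ̈` are simple (PROVED for `2 ≠ 0`)

Mochizuki, *The étale theta function and its Frobenioid-theoretic manifestations*, Publ. RIMS **45**
(2009) 227–349 [cite: MochizukiEtTh2009, Prop 1.4 (i) p.21] (PRIMS PDF p. 21 = printed p. 247). Layer L2 of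
the abc-iut cell, wave-2 unit W2-L2-02 (seat abc-iut-L2-t6); sequel to `ClassicalThetaZeros.lean`
(factorisation `Θ̈(Ü) = Ü (Ü² - 1) H(Ü)`, `‖H(Ü)‖ = ‖Ü‖^{-2}` on the annulus `‖q̈‖ < ‖Ü‖ ≤ 1`).

* `deriv_thetaDdot_cusp_ne_zero` — PROVED under the hypothesis `(2 : L) ≠ 0`: `Θ̈` has nonvanishing
  derivative at every cusp `±q̈^a` ("each zero has multiplicity 1", Prop. 1.4 (i)); packaged as
  `thetaDdotSimpleZeros_of_two_ne_zero`. The paper's fields `K̈ ⊇ ℚ_p` have characteristic `0`, so this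
  covers every instance [EtTh] uses.
* FINDING on the fact AS TYPED (kernel-visible): the named fact `ThetaDdotSimpleZeros` of
  `ClassicalTheta.lean` quantifies over ALL complete nontrivially normed ultrametric fields, with no
  restriction on the characteristic. In characteristic `2` the cusps `Ü = 1` and `Ü = -1` coincide and the
  zero is double: `deriv_thetaDdot_one_eq_zero_of_two_eq_zero` PROVES `Θ̈'(1) = 0` whenever `(2 : L) = 0`,
  `two_ne_zero_of_thetaDdotSimpleZeros` shows the fact forces `(2 : L) ≠ 0` in every such field (the
  companion `ClassicalThetaCharTwo.lean` instantiates this at `L = 𝔽₂((X))` to conclude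
  `¬ ThetaDdotSimpleZeros`). The statement [EtTh] needs (its `K̈ ⊇ ℚ_p` has characteristic `0`) is the
  repaired one proved here; the paper is not affected.

**Method.** `H` is continuous at `1` (uniform convergence on the residue ball `‖Ü - 1‖ < 1`, where every
term `n` has norm `≤ ‖q̈‖^{n(n+1)}`), so the difference quotient `Θ̈(Ü)/(Ü - 1) = Ü (Ü + 1) H(Ü) → 2 H(1)`:
`Θ̈'(1) = 2 H(1)` with `‖H(1)‖ = 1` (`hasDerivAt_thetaDdot_one`). The functional equations
`Θ̈(-Ü) = -Θ̈(Ü)` and `Θ̈(q̈^a Ü) = (-1)^a q̈^{-a²} Ü^{-2a} Θ̈(Ü)` (Prop. 1.4 (ii)) transport this to `-1` and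
to `±q̈^a` (chain and product rules).

Prop. 1.4 is classical and undisputed; HONEST FRAMING: this file takes no side on any disputed claim.
-/

namespace Literature.AnabelianGeometry.EtaleTheta

open Filter Finset
open scoped _root_.Topology

section GeomSum

variable {𝕜 : Type*} [NormedField 𝕜]

/-- `G_n` is continuous away from `V = 0`. (elementary; auxiliary for Prop. 1.4 (i))
[cite: MochizukiEtTh2009, Prop 1.4 (i) p.21] -/
theorem continuousOn_geomSumZ (n : ℤ) : ContinuousOn (fun V : 𝕜 => geomSumZ V n) {0}ᶜ := by
  cases n with
  | ofNat n =>
    simp only [Int.ofNat_eq_natCast, geomSumZ_natCast]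
    exact (continuous_finsetSum _ fun j _ => continuous_id.pow j).continuousOn
  | negSucc m =>
    simp only [geomSumZ_negSucc]
    exact ((continuousOn_inv₀.pow (m + 1)).mul
      (continuous_finsetSum _ fun j _ => continuous_id.pow j).continuousOn).neg

end GeomSum

/-! ### Simplicity of the zeros (Proposition 1.4 (i), "multiplicity 1") -/

section SimpleZeros

variable {L : Type*} [NontriviallyNormedField L] [IsUltrametricDist L]

/-- In an ultrametric field the residue ball `‖Ü - 1‖ < 1` lies on the unit sphere. [folklore] -/
private theorem norm_eq_one_of_mem_ball {U : L} (hU : U ∈ Metric.ball (1 : L) 1) : ‖U‖ = 1 := by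
  rw [Metric.mem_ball, dist_eq_norm] at hU
  have h := IsUltrametricDist.norm_add_eq_max_of_norm_ne_norm (x := U - 1) (y := (1 : L))
    (by rw [norm_one]; exact hU.ne)
  rwa [sub_add_cancel, norm_one, max_eq_right hU.le] at h

variable [CompleteSpace L]

/-- `H` is continuous on the residue ball `‖Ü - 1‖ < 1` (uniform convergence: there every term `n` has
norm `≤ ‖q̈‖^{n(n+1)}`). [cite: MochizukiEtTh2009, Prop 1.4 (i) p.21] -/
theorem continuousOn_thetaDdotAux {q2 : L} (hq : ‖q2‖ < 1) :
    ContinuousOn (thetaDdotAux q2) (Metric.ball 1 1) := by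
  have h0 : Set.MapsTo (fun U : L => U ^ 2) (Metric.ball (1 : L) 1) {0}ᶜ := fun U hU =>
    pow_ne_zero 2 (norm_pos_iff.mp (by rw [norm_eq_one_of_mem_ball hU]; exact one_pos))
  refine continuousOn_tsum (u := fun n : ℤ => ‖thetaDdotTerm q2 1 n‖) (fun n => ?_)
    (summable_norm_thetaDdotTerm hq 1) fun n U hU => ?_
  · change ContinuousOn (fun U => ((n.negOnePow : ℤ) : L) * q2 ^ (n * (n + 1)) * geomSumZ (U ^ 2) n) _
    exact continuousOn_const.mul ((continuousOn_geomSumZ n).comp (continuous_pow 2).continuousOn h0)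
  · have hU1 : ‖U‖ = 1 := norm_eq_one_of_mem_ball hU
    rw [norm_thetaDdotTerm_one]
    cases n with
    | ofNat n =>
      rw [Int.ofNat_eq_natCast, natCast_mul_natCast_add_one, zpow_natCast]
      exact norm_thetaDdotAuxTerm_natCast_le hU1.le n
    | negSucc m =>
      rw [negSucc_mul_negSucc_add_one, zpow_natCast]
      simpa [hU1] using norm_thetaDdotAuxTerm_negSucc_le (q2 := q2) hU1.le m

/-- **`Θ̈` is differentiable at `Ü = 1` with `Θ̈'(1) = 2 H(1)`** (every characteristic): the difference
quotient is `Θ̈(Ü)/(Ü - 1) = Ü (Ü + 1) H(Ü)`. [cite: MochizukiEtTh2009, Prop 1.4 (i) p.21] -/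
theorem hasDerivAt_thetaDdot_one {q2 : L} (hq : ‖q2‖ < 1) :
    HasDerivAt (thetaDdot q2) (2 * thetaDdotAux q2 1) 1 := by
  rw [hasDerivAt_iff_tendsto_slope]
  have hcont : ContinuousAt (thetaDdotAux q2) 1 :=
    (continuousOn_thetaDdotAux hq).continuousAt (Metric.ball_mem_nhds 1 one_pos)
  have hg : Tendsto (fun U => U * (U + 1) * thetaDdotAux q2 U) (𝓝 1) (𝓝 (2 * thetaDdotAux q2 1)) := by
    have hf : ContinuousAt (fun U : L => U * (U + 1)) 1 := by fun_prop
    have h2 : (2 : L) * thetaDdotAux q2 1 = 1 * (1 + 1) * thetaDdotAux q2 1 := by norm_num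
    rw [h2]
    exact (hf.mul hcont).tendsto
  refine (hg.mono_left nhdsWithin_le_nhds).congr' ?_
  filter_upwards [self_mem_nhdsWithin, mem_nhdsWithin_of_mem_nhds (Metric.ball_mem_nhds (1 : L) one_pos)]
    with U hU1 hUb
  have hU : ‖U‖ = 1 := norm_eq_one_of_mem_ball hUb
  have hU0 : U ≠ 0 := norm_pos_iff.mp (by rw [hU]; exact one_pos)
  have hne : U - 1 ≠ 0 := sub_ne_zero.mpr hU1
  rw [slope_def_field, thetaDdot_one_of_norm_lt_one hq, sub_zero,
    thetaDdot_eq_mul_thetaDdotAux hq hU0]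
  field_simp
  ring

/-- `Θ̈'(1) = 2 H(1)`. [cite: MochizukiEtTh2009, Prop 1.4 (i) p.21] -/
theorem deriv_thetaDdot_one {q2 : L} (hq : ‖q2‖ < 1) :
    deriv (thetaDdot q2) 1 = 2 * thetaDdotAux q2 1 :=
  (hasDerivAt_thetaDdot_one hq).deriv

/-- `H(1) ≠ 0` (indeed `‖H(1)‖ = 1`). [cite: MochizukiEtTh2009, Prop 1.4 (i) p.21] -/
theorem thetaDdotAux_one_ne_zero {q2 : L} (hq : ‖q2‖ < 1) : thetaDdotAux q2 1 ≠ 0 := by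
  rw [← norm_pos_iff, norm_thetaDdotAux_eq hq (by rwa [norm_one]) (by rw [norm_one])]
  norm_num

/-- **Characteristic 2: the zero at `Ü = 1` is NOT simple.** If `(2 : L) = 0` then `Θ̈'(1) = 0`
(the cusps `Ü = 1` and `Ü = -1` coincide). This is why the simple-zeros statement needs
`(2 : L) ≠ 0`. [cite: MochizukiEtTh2009, Prop 1.4 (i) p.21] -/
theorem deriv_thetaDdot_one_eq_zero_of_two_eq_zero {q2 : L} (hq : ‖q2‖ < 1) (h2 : (2 : L) = 0) :
    deriv (thetaDdot q2) 1 = 0 := by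
  rw [deriv_thetaDdot_one hq, h2, zero_mul]

/-- `Θ̈` is differentiable at `Ü = -1` with the same derivative as at `1` (from `Θ̈(-Ü) = -Θ̈(Ü)`).
[cite: MochizukiEtTh2009, Prop 1.4 (i) p.21] -/
theorem hasDerivAt_thetaDdot_neg_one {q2 : L} (hq : ‖q2‖ < 1) :
    HasDerivAt (thetaDdot q2) (2 * thetaDdotAux q2 1) (-1) := by
  have h1 : HasDerivAt (thetaDdot q2) (2 * thetaDdotAux q2 1) (-(-1)) := by
    rw [neg_neg]
    exact hasDerivAt_thetaDdot_one hq
  have h := (h1.comp (-1) (hasDerivAt_neg (-1))).neg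
  have hfun : -(thetaDdot q2 ∘ Neg.neg) = thetaDdot q2 :=
    funext fun x => by rw [Pi.neg_apply, Function.comp_apply, thetaDdot_neg, neg_neg]
  rw [hfun] at h
  exact h.congr_deriv (by ring)

omit [IsUltrametricDist L] [CompleteSpace L] in
/-- **Transport along the functional equation**: if `Θ̈(Ü₀) = 0` and `Θ̈` has derivative `d` at `Ü₀ ≠ 0`,
then at `q̈^a Ü₀` it has derivative `c · d` for an explicit unit `c` (from
`Θ̈(W) = (-1)^a q̈^{-a²} (q̈^{-a} W)^{-2a} Θ̈(q̈^{-a} W)`, Prop. 1.4 (ii)). [cite: MochizukiEtTh2009, Prop 1.4 (ii) p.22] -/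
theorem exists_hasDerivAt_thetaDdot_zpow_mul {q2 U₀ d : L} (hq0 : q2 ≠ 0) (hU₀ : U₀ ≠ 0)
    (h0 : thetaDdot q2 U₀ = 0) (hd : HasDerivAt (thetaDdot q2) d U₀) (a : ℤ) :
    ∃ c : L, c ≠ 0 ∧ HasDerivAt (thetaDdot q2) (c * d) (q2 ^ a * U₀) := by
  set W₀ : L := q2 ^ a * U₀ with hW₀def
  have hqa : q2 ^ a ≠ 0 := zpow_ne_zero a hq0
  have hqa' : q2 ^ (-a) ≠ 0 := zpow_ne_zero _ hq0
  have hW₀ : W₀ ≠ 0 := mul_ne_zero hqa hU₀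
  have hW : q2 ^ (-a) * W₀ = U₀ := by rw [hW₀def, zpow_neg, inv_mul_cancel_left₀ hqa]
  set κ : L := ((a.negOnePow : ℤ) : L) * q2 ^ (-(a * a)) * (q2 ^ (-a)) ^ (-(2 * a)) with hκ
  have hs : ((a.negOnePow : ℤ) : L) ≠ 0 := by
    rw [Int.cast_negOnePow]
    exact zpow_ne_zero _ (neg_ne_zero.mpr one_ne_zero)
  have hκ0 : κ ≠ 0 := mul_ne_zero (mul_ne_zero hs (zpow_ne_zero _ hq0)) (zpow_ne_zero _ hqa')
  have hG : HasDerivAt (fun W : L => κ * W ^ (-(2 * a)))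
      (κ * (((-(2 * a) : ℤ) : L) * W₀ ^ (-(2 * a) - 1))) W₀ :=
    (hasDerivAt_zpow (-(2 * a)) W₀ (Or.inl hW₀)).const_mul κ
  have hK : HasDerivAt (fun W : L => thetaDdot q2 (q2 ^ (-a) * W)) (d * (q2 ^ (-a) * 1)) W₀ := by
    have hd' : HasDerivAt (thetaDdot q2) d (q2 ^ (-a) * W₀) := by rwa [hW]
    exact hd'.comp W₀ ((hasDerivAt_id W₀).const_mul (q2 ^ (-a)))
  have hF := hG.mul hK
  rw [hW, h0, mul_zero, zero_add] at hF
  refine ⟨κ * W₀ ^ (-(2 * a)) * q2 ^ (-a), mul_ne_zero (mul_ne_zero hκ0 (zpow_ne_zero _ hW₀)) hqa', ?_⟩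
  refine (hF.congr_of_eventuallyEq ?_).congr_deriv (by ring)
  filter_upwards [eventually_ne_nhds hW₀] with W hW'
  have hU : q2 ^ (-a) * W ≠ 0 := mul_ne_zero hqa' hW'
  have h := thetaDdot_zpow_mul hq0 hU a
  rw [← mul_assoc, ← zpow_add₀ hq0, add_neg_cancel, zpow_zero, one_mul] at h
  rw [Pi.mul_apply, h, mul_zpow, hκ]
  ring

/-- **Prop. 1.4 (i), "each zero has multiplicity 1", nonarchimedean (PROVED for `(2 : L) ≠ 0`)**:
`Θ̈` has nonvanishing derivative at every cusp `Ü = ±q̈^a` (`0 < ‖q̈‖ < 1`). The hypothesis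
`(2 : L) ≠ 0` is necessary (`deriv_thetaDdot_one_eq_zero_of_two_eq_zero`) and holds for the paper's
`K̈ ⊇ ℚ_p`. [cite: MochizukiEtTh2009, Prop 1.4 (i) p.21] -/
theorem deriv_thetaDdot_cusp_ne_zero {q2 : L} (h2 : (2 : L) ≠ 0) (hq0 : 0 < ‖q2‖) (hq : ‖q2‖ < 1)
    (a : ℤ) : deriv (thetaDdot q2) (q2 ^ a) ≠ 0 ∧ deriv (thetaDdot q2) (-(q2 ^ a)) ≠ 0 := by
  have hq0' : q2 ≠ 0 := norm_pos_iff.mp hq0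
  have hd : (2 : L) * thetaDdotAux q2 1 ≠ 0 := mul_ne_zero h2 (thetaDdotAux_one_ne_zero hq)
  constructor
  · obtain ⟨c, hc, h⟩ := exists_hasDerivAt_thetaDdot_zpow_mul hq0' one_ne_zero
      (thetaDdot_one_of_norm_lt_one hq) (hasDerivAt_thetaDdot_one hq) a
    rw [mul_one] at h
    rw [h.deriv]
    exact mul_ne_zero hc hd
  · obtain ⟨c, hc, h⟩ := exists_hasDerivAt_thetaDdot_zpow_mul hq0' (neg_ne_zero.mpr one_ne_zero)
      (by rw [thetaDdot_neg, thetaDdot_one_of_norm_lt_one hq, neg_zero])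
      (hasDerivAt_thetaDdot_neg_one hq) a
    rw [mul_neg_one] at h
    rw [h.deriv]
    exact mul_ne_zero hc hd

end SimpleZeros

/-! ### Change of field (for values computed in a bigger, possibly non-complete field such as `ℚ̄_p`) -/

section Map

variable {E L' : Type*} [NormedField E] [NormedField L']

/-- `Θ̈` commutes with continuous field homomorphisms `σ : E → L'` wherever its series is summable in `E`
(e.g. `E ⊇ K̈` a finite extension of `ℚ_p`, complete, embedded in `ℚ̄_p` or `ℂ_p`): `σ(Θ̈(q̈, Ü)) =
Θ̈(σ q̈, σ Ü)`. Hence the zero-locus and multiplicity results of this file and of `ClassicalThetaZeros.lean`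
(which need completeness) govern values computed in the bigger field. [cite: MochizukiEtTh2009, Prop 1.4 p.21] -/
theorem map_thetaDdot (σ : E →+* L') (hσ : Continuous σ) {q2 U : E}
    (hs : Summable (thetaDdotTerm q2 U)) : σ (thetaDdot q2 U) = thetaDdot (σ q2) (σ U) := by
  have hT : ∀ n, σ (thetaDdotTerm q2 U n) = thetaDdotTerm (σ q2) (σ U) n := fun n => by
    simp only [thetaDdotTerm, map_mul, map_zpow₀, map_intCast]
  rw [thetaDdot, thetaDdot, ← (hs.hasSum.map σ hσ).tsum_eq]
  exact tsum_congr fun n => hT n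

end Map

/-- **The repaired simple-zeros statement, PROVED**: the named fact `ThetaDdotSimpleZeros` of
`ClassicalTheta.lean` with the (necessary) extra hypothesis `(2 : L) ≠ 0`.
[cite: MochizukiEtTh2009, Prop 1.4 (i) p.21] -/
theorem thetaDdotSimpleZeros_of_two_ne_zero (L : Type*) [NontriviallyNormedField L] [CompleteSpace L]
    [IsUltrametricDist L] (h2 : (2 : L) ≠ 0) (q2 : L) (hq0 : 0 < ‖q2‖) (hq : ‖q2‖ < 1) (a : ℤ) :
    deriv (thetaDdot q2) (q2 ^ a) ≠ 0 ∧ deriv (thetaDdot q2) (-(q2 ^ a)) ≠ 0 :=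
  deriv_thetaDdot_cusp_ne_zero h2 hq0 hq a

/-- **What the fact as typed asserts beyond the paper**: `ThetaDdotSimpleZeros` (no characteristic
hypothesis) implies `(2 : L) ≠ 0` for EVERY complete nontrivially normed ultrametric field `L` — so it
is contradicted by any such field of characteristic `2` (e.g. `𝔽₂((t))`); the statement [EtTh] needs and
this file proves is `thetaDdotSimpleZeros_of_two_ne_zero`. [cite: MochizukiEtTh2009, Prop 1.4 (i) p.21] -/
theorem two_ne_zero_of_thetaDdotSimpleZeros (h : ThetaDdotSimpleZeros) (L : Type)
    [NontriviallyNormedField L] [CompleteSpace L] [IsUltrametricDist L] : (2 : L) ≠ 0 := by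
  intro h2
  obtain ⟨q2, hq0, hq⟩ := NormedField.exists_norm_lt_one L
  exact (h L q2 hq0 hq 0).1 (by rw [zpow_zero, deriv_thetaDdot_one_eq_zero_of_two_eq_zero hq h2])

end Literature.AnabelianGeometry.EtaleTheta
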